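import Mathlib
import HarnessLib
import Literature.MathematicalPhysics.QuantumFieldTheory.WilsonPlaquetteWeakCouplingFloor
import Summits.Ventures.LatticeQCDFlow.Scaling.AutoregressiveGaugePlaquetteTVFloorAnyLink
import Summits.Ventures.LatticeQCDFlow.Scaling.AutoregressiveProposalKLPinsker

/-!
# LatticeQCDFlow / Scaling — the learned heat bath, LOSS SIDE: a single-link proposal that ignores the links
# at one endpoint of its link has per-link training loss `κ ≥ ⟨(1/N)Re tr U_p⟩_β²/2 ≥ f(r)²/2` at every volume

HONEST FRAMING: exact (Metropolis-corrected) sampling algorithms for lattice gauge theory;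
figures of merit are autocorrelation/cost numbers at stated couplings and volumes; no
continuum-physics claim.

Venture `LatticeQCDFlow` (cell pub-lqcd), topic `Scaling`, FANOUT row 30 (lean-1, GEN-20) — OUR WORK on
THEORY-2.md §4 row C5, the training-loss twin of gen-19's `Scaling/AutoregressiveGaugeSiteAcceptanceCeiling`
(a learned single-link heat bath with an endpoint-blind proposal accepts `≤ 1 − ⟨W⟩/2`).  Assembled from
`Scaling/AutoregressiveGaugePlaquetteTVFloorAnyLink.wilson_condGap_ge_plaquette_of_mem` (with the empty
integrated set: the conditional `L¹` error of an endpoint-blind proposal is `≥ (1/N)∫Re tr ρ(U_p)F`),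
`Scaling/AutoregressiveProposalKLPinsker.sq_integral_abs_condGap_le` (one-step Pinsker, `s = ∅`) and the
tree's plaquette positivity / weak-coupling floor.

## What is proved (all [ours]; assembled)

* **`wilson_siteKL_ge_half_sq_plaquette`** — Wilson weight, continuous `ρ` with a central scalar
  `ω ≠ 1`, `|ω| = 1`, `N ≥ 1`, `β > 0`, `L ≥ 2`; a link `e` of a plaquette `p`; a single-link proposal
  `q(·|rest)` (measurable, `0 < c_q ≤ q ≤ C_q`, normalised in `e`) blind to every other link at an endpoint
  `y` of `e`: `⟨(1/N)Re tr U_p⟩_β²/2 ≤ κ_e := Z⁻¹∫F log(F/(q·A_eF)) dπ` — the mean relative entropy of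
  the exact one-link conditional from the proposal.
* **`wilson_siteKL_ge_half_linkBall_sq`** — unitary `ρ`, `d ≥ 2`, any `r > 0` with `f(r) ≥ 0`:
  `f(r)²/2 ≤ κ_e`, uniformly in the volume (`f(r) = 1 − 8r²/N + 2log φ_ρ(r)/((d−1)Nβ) → 1` as `β → ∞`).

READING (value-free): a learned heat bath whose proposal for a link does not look at the links already
in place at one endpoint of that link cannot be trained below `f(r)²/2` nats per link (half a nat squared
of the volume-uniform plaquette floor), whatever its capacity; with gen-19's acceptance floor/ceiling this
brackets such samplers from both sides.  NOT CLAIMED: proposals reading both endpoints; the reverse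
divergence; autocorrelations of the sweep.  No `def`, no `sorry`, nothing cited as a fact beyond the tree.
-/

noncomputable section

namespace Summit.Ventures.LatticeQCDFlow.Theory2.Autoregressive

open MeasureTheory Function Set
open Literature.MathematicalPhysics.QuantumFieldTheory Literature.MathematicalPhysics.QuantumLattice
open Summit.Ventures.LatticeQCDFlow.Exactness
open scoped Matrix Matrix.Norms.Frobenius

section Wilson

variable {d L N : ℕ} {G : Type*} [Group G] [TopologicalSpace G] [IsTopologicalGroup G]
  [CompactSpace G] [SecondCountableTopology G] [MeasurableSpace G] [BorelSpace G] [NeZero L]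
  (ρ : G →* Matrix (Fin N) (Fin N) ℂ)

/-- **THE PER-LINK LOSS FLOOR OF AN ENDPOINT-BLIND HEAT BATH, plaquette-mean form.**  `β > 0`, `N ≥ 1`,
continuous `ρ` with a central element acting by `ω ≠ 1`, `|ω| = 1`, `L ≥ 2`; `e` a link of the plaquette
`p`; `q` measurable, `0 < c_q ≤ q ≤ C_q`, normalised in `e`, blind to every other link at an endpoint `y`
of `e`.  Then `⟨(1/N)Re tr U_p⟩_β²/2 ≤ Z⁻¹∫F·log(F/(q·A_eF)) dπ` (`F = e^{−βS_W}`). [ours] -/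
theorem wilson_siteKL_ge_half_sq_plaquette [NeZero N] (hρ : Continuous ρ) (hL : 2 ≤ L)
    {z : G} {ω : ℂ} (hω : ρ z = ω • (1 : Matrix (Fin N) (Fin N) ℂ)) (hω1 : ‖ω‖ = 1) (hne : ω ≠ 1)
    {β : ℝ} (hβ : 0 < β) (p : Plaquette d L) {e : Edge d L}
    (he : e ∈ ({(p.1, p.2.1.1), (p.1.shift p.2.1.1, p.2.1.2), (p.1.shift p.2.1.2, p.2.1.1), (p.1, p.2.1.2)} :
      Finset (Edge d L)))
    {q : GaugeConfig d L G → ℝ} (hqm : Measurable q) {cq Cq : ℝ} (hcq : 0 < cq)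
    (hqlo : ∀ U, cq ≤ q U) (hqhi : ∀ U, q U ≤ Cq)
    (hq1 : ∀ U, ∫ v, q (update U e v) ∂(haarProbability G) = 1)
    {y : Site d L} (hy : e.1 = y ∨ e.1.shift e.2 = y)
    (hqB : ∀ e' : Edge d L, e'.1 = y ∨ e'.1.shift e'.2 = y → e' ≠ e →
      ∀ (U : GaugeConfig d L G) (v : G), q (update U e' v) = q U) :
    (wilsonExpectation ρ β (fun U : GaugeConfig d L G =>
        (N : ℝ)⁻¹ * (ρ (plaquetteHolonomy U p.1 p.2.1.1 p.2.1.2)).trace.re)) ^ 2 / 2 ≤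
      (∫ U, Real.exp (-β * wilsonAction ρ U) *
          Real.log (Real.exp (-β * wilsonAction ρ U) /
            (q U * coordAvg (haarProbability G) {e}
              (fun V : GaugeConfig d L G => Real.exp (-β * wilsonAction ρ V)) U))
          ∂Measure.pi (fun _ : Edge d L => haarProbability G)) /
        ∫ W, Real.exp (-β * wilsonAction ρ W) ∂Measure.pi (fun _ : Edge d L => haarProbability G) := by
  classical
  set μ := haarProbability G with hμ
  set π := Measure.pi (fun _ : Edge d L => μ) with hπ
  set F : GaugeConfig d L G → ℝ := fun U => Real.exp (-β * wilsonAction ρ U) with hF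
  set Z : ℝ := ∫ W, F W ∂π with hZ
  obtain ⟨hFm, B, hFlo, hFhi⟩ := wilsonWeight_props (d := d) (L := L) ρ hρ β
  have hZpos : 0 < Z :=
    integral_exp_pos (Literature.Probability.LatticeModels.integrable_of_continuous_compactSpace _
      (Real.continuous_exp.comp (continuous_const.mul (continuous_wilsonAction ρ hρ))))
  haveI : Fact (1 < L) := ⟨hL⟩
  have hq0 : ∀ U, 0 ≤ q U := fun U => hcq.le.trans (hqlo U)
  have hkl : p.2.1.1 ≠ p.2.1.2 := ne_of_lt p.2.2
  -- the `L¹` floor with the empty integrated set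
  have hlin := wilson_condGap_ge_plaquette_of_mem (d := d) (L := L) ρ hρ hL hω hne β p he
    (s := (∅ : Finset (Edge d L))) (Finset.empty_subset _) hqm hq0 hqhi hq1 hy hqB
  simp only [coordAvg_empty, Finset.insert_empty] at hlin
  -- Pinsker for the step `s = ∅`
  have hblind : ∀ U U' : GaugeConfig d L G, q ((∅ : Finset (Edge d L)).piecewise U' U) = q U :=
    fun U U' => by simp
  have hpin := sq_integral_abs_condGap_le μ (∅ : Finset (Edge d L)) (Finset.notMem_empty e) hFm
    (Real.exp_pos _) hFlo hFhi hqm hcq hqlo hqhi hq1 hblind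
  simp only [coordAvg_empty, Finset.insert_empty] at hpin
  -- the plaquette mean is `N⁻¹ X / Z ≥ 0`
  set X : ℝ := ∫ U, (ρ (plaquetteHolonomy U p.1 p.2.1.1 p.2.1.2)).trace.re * F U ∂π with hX
  have hpos := wilsonExpectation_re_trace_plaquette_pos (d := d) (L := L) ρ hρ hω hω1 hne hβ p.1 hkl
  rw [wilsonExpectation_eq_integral_div ρ hρ] at hpos ⊢
  have hnum : ∫ U, (N : ℝ)⁻¹ * (ρ (plaquetteHolonomy U p.1 p.2.1.1 p.2.1.2)).trace.re * F U ∂π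
      = (N : ℝ)⁻¹ * X := by
    rw [hX, ← integral_const_mul]
    refine integral_congr_ae (ae_of_all _ fun U => ?_)
    ring
  rw [hnum]
  have hX0 : 0 ≤ X := ((div_pos_iff_of_pos_right hZpos).1 hpos).le
  have h0 : 0 ≤ (N : ℝ)⁻¹ * X := mul_nonneg (inv_nonneg.2 (Nat.cast_nonneg N)) hX0
  -- `((1/N)X)² ≤ (∫|F − qA_eF|)² ≤ 2 Z K`
  set D : ℝ := ∫ U, |F U - q U * coordAvg μ {e} F U| ∂π with hD
  set K : ℝ := ∫ U, F U * Real.log (F U / (q U * coordAvg μ {e} F U)) ∂π with hK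
  have h1 : ((N : ℝ)⁻¹ * X) ^ 2 ≤ D ^ 2 := pow_le_pow_left₀ h0 hlin 2
  have h2 : D ^ 2 ≤ 2 * Z * K := hpin
  calc ((N : ℝ)⁻¹ * X / Z) ^ 2 / 2 = ((N : ℝ)⁻¹ * X) ^ 2 / (2 * Z ^ 2) := by
        rw [div_pow]; ring
    _ ≤ 2 * Z * K / (2 * Z ^ 2) := div_le_div_of_nonneg_right (h1.trans h2) (by positivity)
    _ = K / Z := by field_simp

/-- **THE PER-LINK LOSS FLOOR, VOLUME-UNIFORM NUMBER**: under the hypotheses of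
`wilson_siteKL_ge_half_sq_plaquette` with `ρ` unitary and `d ≥ 2`, for every `r > 0` such that
`f(r) = 1 − 8r²/N + 2 log φ_ρ(r)/((d−1)Nβ) ≥ 0`: `f(r)²/2 ≤ Z⁻¹∫F·log(F/(q·A_eF)) dπ`. [ours] -/
theorem wilson_siteKL_ge_half_linkBall_sq [NeZero N] (hd : 2 ≤ d) (hN : 1 ≤ N) (hρ : Continuous ρ)
    (hρU : ∀ g, ρ g ∈ Matrix.unitaryGroup (Fin N) ℂ) (hL : 2 ≤ L)
    {z : G} {ω : ℂ} (hω : ρ z = ω • (1 : Matrix (Fin N) (Fin N) ℂ)) (hω1 : ‖ω‖ = 1) (hne : ω ≠ 1)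
    {β : ℝ} (hβ : 0 < β) {r : ℝ} (hr : 0 < r)
    (hf : 0 ≤ 1 - 8 * r ^ 2 / N +
      2 * Real.log ((haarProbability G).real {g : G | ‖ρ g - 1‖ ≤ r}) / (((d : ℝ) - 1) * N * β))
    (p : Plaquette d L) {e : Edge d L}
    (he : e ∈ ({(p.1, p.2.1.1), (p.1.shift p.2.1.1, p.2.1.2), (p.1.shift p.2.1.2, p.2.1.1), (p.1, p.2.1.2)} :
      Finset (Edge d L)))
    {q : GaugeConfig d L G → ℝ} (hqm : Measurable q) {cq Cq : ℝ} (hcq : 0 < cq)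
    (hqlo : ∀ U, cq ≤ q U) (hqhi : ∀ U, q U ≤ Cq)
    (hq1 : ∀ U, ∫ v, q (update U e v) ∂(haarProbability G) = 1)
    {y : Site d L} (hy : e.1 = y ∨ e.1.shift e.2 = y)
    (hqB : ∀ e' : Edge d L, e'.1 = y ∨ e'.1.shift e'.2 = y → e' ≠ e →
      ∀ (U : GaugeConfig d L G) (v : G), q (update U e' v) = q U) :
    (1 - 8 * r ^ 2 / N +
        2 * Real.log ((haarProbability G).real {g : G | ‖ρ g - 1‖ ≤ r}) / (((d : ℝ) - 1) * N * β)) ^ 2 / 2 ≤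
      (∫ U, Real.exp (-β * wilsonAction ρ U) *
          Real.log (Real.exp (-β * wilsonAction ρ U) /
            (q U * coordAvg (haarProbability G) {e}
              (fun V : GaugeConfig d L G => Real.exp (-β * wilsonAction ρ V)) U))
          ∂Measure.pi (fun _ : Edge d L => haarProbability G)) /
        ∫ W, Real.exp (-β * wilsonAction ρ W) ∂Measure.pi (fun _ : Edge d L => haarProbability G) := by
  have hkl : p.2.1.1 ≠ p.2.1.2 := ne_of_lt p.2.2
  have hmain := wilson_siteKL_ge_half_sq_plaquette (d := d) (L := L) ρ hρ hL hω hω1 hne hβ p he hqm hcq hqlo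
    hqhi hq1 hy hqB
  have hfloor := wilsonExpectation_plaquette_ge_linkBall (d := d) (L := L) ρ hd hN hρ hρU hβ hr p.1 hkl
  have hsq := pow_le_pow_left₀ hf hfloor 2
  exact le_trans (div_le_div_of_nonneg_right hsq (by norm_num)) hmain

end Wilson

end Summit.Ventures.LatticeQCDFlow.Theory2.Autoregressive

end
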